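import Summits.BirchSwinnertonDyer.BirchSwinnertonDyer.Theses.PrintX9
import Summits.BirchSwinnertonDyer.BirchSwinnertonDyer.Theorems.PrintX9HowardContainmentPinnedRung
import Summits.BirchSwinnertonDyer.BirchSwinnertonDyer.Theorems.PrintX9HowardContainmentLightFramePinnedOfPrintSharpStubEnvelope
import Literature.NumberTheory.EllipticCurves.IwasawaAlgebraPromotionProofs
import Literature.NumberTheory.EllipticCurves.HeegnerCharIdealEnvelopeProofs
import Literature.NumberTheory.EllipticCurves.HeegnerCharIdealEnvelopePowTransferProofs
import Literature.NumberTheory.EllipticCurves.CastellaGrossiSkinner2025.HeegnerKolyvaginBoundAnyClassNumberProofs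
import HarnessLib

/-!
# The deciding crux `PrintX9.HowardContainmentLightFramePinnedOfPrintSharp` (stmt-BirchSwinnertonDyer-27077) from the
# STABILISED μ-inequality `μ(𝒳_tors) ≤ 2·μ(𝔖/Λκ_∞(C))` — the residual in the currency the Kolyvagin road delivers

Cell `pub/bsd-print-x9`, seat `bsd-line-x9-p1-w2` (g3, stub worker s4 under LEAD `bsd-line-x9-p1`), `--supports`
stmt-BirchSwinnertonDyer-27077. HONEST FRAMING: a CONDITIONAL closer and a statement abbreviation; nothing is asserted,
no named fact is introduced, no stub and no item is closed by this file; «beyond-print theorem»: no; BSD is NOT proved.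

WHY THIS FILE. The registered residual stub of the skeleton of record on 27077 (v5.1), `stub_muPartSharp :
Stmt.muPartSharp` (tree copy: `PrintX9SharpMuPart.Stmt.muPartSharp`, p622945), promotes the `p`-localized TIED
containment to the integral one for EVERY Heegner family `F` on the frame's parametrisation `Dt` (its hypothesis
package is quantified `∀ (D, F, X, m)` with `F.Dt = Dt`). The road that is to prove the μ-part at `p ∣ h_K` — Howard's
Eisenstein specialisation `q_m = T^m + p` of the Λ-adic Kolyvagin system (How04, proof of Thm. 2.2.10, case `𝔓 = pΛ`;
crux card `Cruxes/HowardContainmentAnyClassNumberX10b/Lines/specialise-first-mu-x10b.md`, pieces K1/K1μ) — outputs the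
μ-inequality in the STABILISED currency of Castella–Grossi–Lee–Skinner, for the stabilised data `C`:
`length_(p)(𝒳_tors) ≤ 2 · length_(p)(𝔖/Λκ_∞(C))`, with no Heegner family `F`, no `Dt`, and no class-number input.
Passing from `C` to a family `F` needs the module inclusion `ℋ_F ≤ Λκ_∞(C)`, which the tree proves for the engine's
OWN coherent pair `(C₀, F₀)` (`exists_coherent_pair_envelope`, x9-p2 p621134, exponent `e = 0`) and NOT for an
arbitrary family with `F.Dt = Dt` (that would take Shimura transitivity at conductor `p^{j+1}` and the
Atkin–Lehner/orientation independence of `ℋ_F`, neither in the tree). Hence this file states the residual as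
`Stmt.muInequalityStabilized` (the stabilised μ-inequality on light X9 frames at `p ∣ h_K`, ∀ `C`) and proves the crux
from it BY NAME, re-running the engine inside the composition so that the family fed to the conclusion IS `F₀`:

* §1 `Stmt.muInequalityStabilized` (local-length currency) and `Stmt.muInvariantInequalityStabilized` (`muInvariant`
  currency), with `muInequalityStabilized_of_muInvariantInequalityStabilized`.
* §2 `howardContainmentLightFramePinnedOfPrintSharp_of_muStabilized :
  Stmt.muInequalityStabilized → HowardContainmentLightFramePinnedOfPrintSharp` and its `muInvariant` twin.

Proof of §2 (`p ∣ h_K` branch; `p ∤ h_K` is `PrintX9Rung.stmt_coprimeTied hMZ`, MZ26 Cor. 4.6 by name): `D`, `X` exist;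
the engine gives `(C₀, F₀)` on `Dt` with `ℋ_{F₀} ≤ Λκ_{C₀}` and `g • Λκ_{C₀} ≤ ℋ_{F₀}`, `g ≠ 0`; CGLS 4.1.1 (`hNV`) makes
`𝔖/Λκ_{C₀}` torsion, hence `𝔖/ℋ_{F₀}` torsion and `I(ℋ_{F₀}) ⊆ I(Λκ_{C₀})`
(`heegnerCharIdeal_le_stabilizedHeegnerCharIdeal_of_le`); CGS 6.5.2 (`hCGS`) gives `(p^m)·I(Λκ_{C₀})² ⊆ char(𝒳_tors)`;
the hypothesis at `(D, C₀, X)` and x10b-p1's promotion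
`IwasawaAlgebra.sq_charIdeal_le_charIdeal_of_span_p_pow_mul_le_of_lengthAt_le_two_mul` give
`I(Λκ_{C₀})² ⊆ char(𝒳_tors)`, whence `I(ℋ_{F₀})² ⊆ char(𝒳_tors)` with `F₀.Dt = Dt`.
-/

set_option linter.dupNamespace false
set_option autoImplicit false

noncomputable section

open scoped Classical Pointwise
open Literature Literature.NumberTheory.EllipticCurves WeierstrassCurve
  Literature.NumberTheory.EllipticCurves.ModularForms
open Summit.BirchSwinnertonDyer.BirchSwinnertonDyer.Theses.PrintX9

namespace Summit.BirchSwinnertonDyer.BirchSwinnertonDyer.Theorems.PrintX9SharpMuStabilized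

/-! ## §1 The residual in the stabilised currency -/

/-- **The stabilised μ-inequality on light X9 frames at `p ∣ h_K`** (local-length currency): for every rank-one
light X9 Heegner frame (binders of the crux verbatim up to the generator `γ`), every `jbar`, every `Λ`-adic Selmer
datum `D`, every CGLS stabilised Heegner datum `C` and every Selmer dual `X`, with `𝔖 = D.S` and `𝒳 = X.X` finitely
generated and `𝔖/Λκ_∞(C)` torsion: `length_{Λ_(p)}(𝒳_tors) ≤ 2 · length_{Λ_(p)}(𝔖/Λκ_∞(C))`. This is Howard's
Theorem B (c) at the prime `(p)` for the stabilised class (How04 Thm. 2.2.10, `𝔓 = pΛ` via `𝔮 = T^m + p`), which print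
proves only under `p ∤ h_K` (Mastella–Zerman 2026, Ass. 2.1 (iii) with Thm. 3.15; Howard 2004, proof of Thm. 2.2.10,
case `𝔓 = pΛ`). A statement abbreviation re-homed Theorems-side exactly like `PrintX9SharpMuPart.Stmt.muPartSharp`;
NOT asserted, NOT a named fact, no citation tag (it is this line's residual, not a published result); no witness in
the tree. -/
abbrev Stmt.muInequalityStabilized : Prop :=
  ∀ (W : WeierstrassCurve ℚ) [W.IsElliptic] [W.IsGloballyMinimal] (p : ℕ) [Fact p.Prime]
    [NeZero (W.conductorNorm ℤ)] (K : Type) [Field K] [NumberField K],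
    Summit.BirchSwinnertonDyer.BirchSwinnertonDyer.Rank1Residual.ClassX9 W p →
    IsImaginaryQuadratic K → Odd (NumberField.discr K) → NumberField.discr K ≠ -3 →
    SatisfiesHeegnerHypothesis (W.conductorNorm ℤ) K → SatisfiesHeegnerHypothesis p K →
    (W.baseChange K).HasIrreducibleModPGaloisRep p →
    ∀ (κ : ZpExtension K p), κ.IsAnticyclotomic → ∀ (γ : Field.absoluteGaloisGroup K),
    κ.IsTopGenerator γ → ∀ (jbar : AlgebraicClosure K →+* ℂ),
    p ∣ NumberField.classNumber K →
    ∀ (D : (W.baseChange K).LambdaAdicSelmerData κ γ)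
      (C : CastellaGrossiLeeSkinner2022.StabilizedHeegnerData (W.conductorNorm ℤ) W K κ jbar)
      (X : (W.baseChange K).SelmerDualData κ γ),
    Module.Finite (IwasawaAlgebra p) D.S → Module.Finite (IwasawaAlgebra p) X.X →
    Module.IsTorsion (IwasawaAlgebra p) (D.S ⧸ CastellaGrossiLeeSkinner2022.stabilizedHeegnerModule D C) →
    ∀ 𝔭 : PrimeSpectrum (IwasawaAlgebra p), 𝔭.asIdeal = Ideal.span {(p : IwasawaAlgebra p)} →
      Module.lengthAt (IwasawaAlgebra p) (Submodule.torsion (IwasawaAlgebra p) X.X) 𝔭 ≤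
        2 * Module.lengthAt (IwasawaAlgebra p)
          (D.S ⧸ CastellaGrossiLeeSkinner2022.stabilizedHeegnerModule D C) 𝔭

/-- **The same residual in the `μ`-invariant currency**: `μ(𝒳_tors) ≤ 2 · μ(𝔖/Λκ_∞(C))` (the tree's
`muInvariant`, `= toNat ∘ length_(p)`; Washington §13.2). A statement abbreviation; NOT asserted, NOT a named fact,
no citation tag. -/
abbrev Stmt.muInvariantInequalityStabilized : Prop :=
  ∀ (W : WeierstrassCurve ℚ) [W.IsElliptic] [W.IsGloballyMinimal] (p : ℕ) [Fact p.Prime]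
    [NeZero (W.conductorNorm ℤ)] (K : Type) [Field K] [NumberField K],
    Summit.BirchSwinnertonDyer.BirchSwinnertonDyer.Rank1Residual.ClassX9 W p →
    IsImaginaryQuadratic K → Odd (NumberField.discr K) → NumberField.discr K ≠ -3 →
    SatisfiesHeegnerHypothesis (W.conductorNorm ℤ) K → SatisfiesHeegnerHypothesis p K →
    (W.baseChange K).HasIrreducibleModPGaloisRep p →
    ∀ (κ : ZpExtension K p), κ.IsAnticyclotomic → ∀ (γ : Field.absoluteGaloisGroup K),
    κ.IsTopGenerator γ → ∀ (jbar : AlgebraicClosure K →+* ℂ),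
    p ∣ NumberField.classNumber K →
    ∀ (D : (W.baseChange K).LambdaAdicSelmerData κ γ)
      (C : CastellaGrossiLeeSkinner2022.StabilizedHeegnerData (W.conductorNorm ℤ) W K κ jbar)
      (X : (W.baseChange K).SelmerDualData κ γ),
    Module.Finite (IwasawaAlgebra p) D.S → Module.Finite (IwasawaAlgebra p) X.X →
    Module.IsTorsion (IwasawaAlgebra p) (D.S ⧸ CastellaGrossiLeeSkinner2022.stabilizedHeegnerModule D C) →
      muInvariant p (Submodule.torsion (IwasawaAlgebra p) X.X) ≤
        2 * muInvariant p (D.S ⧸ CastellaGrossiLeeSkinner2022.stabilizedHeegnerModule D C)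

/-- `(p) = span {C p}`: the two spellings of the height-one prime `(p) ⊂ Λ` agree. [folklore] -/
theorem span_natCast_eq_augIdealP (p : ℕ) [Fact p.Prime] :
    Ideal.span {(p : IwasawaAlgebra p)} = IwasawaAlgebra.augIdealP p := by
  rw [IwasawaAlgebra.augIdealP, map_natCast]

/-- **`μ`-invariant currency ⟹ local-length currency** (both lengths at `(p)` are finite for finitely generated
torsion modules, `lengthAt_ne_top_of_isTorsion`, and `μ = toNat ∘ length_(p)`, `muInvariant_eq_toNat_lengthAt`).
[cite: Washington1997, §13.2] -/
theorem muInequalityStabilized_of_muInvariantInequalityStabilized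
    (h : Stmt.muInvariantInequalityStabilized) : Stmt.muInequalityStabilized := by
  intro W _ _ p _ _ K _ _ hX9 hK hodd h3 hHN hHp hirr κ hκ γ hγ jbar hhK D C X hfinS hfinX htorC 𝔭 h𝔭
  haveI := hfinS
  haveI := hfinX
  haveI : IsNoetherian (IwasawaAlgebra p) X.X := isNoetherian_of_isNoetherianRing_of_finite _ _
  haveI : Module.Finite (IwasawaAlgebra p) (Submodule.torsion (IwasawaAlgebra p) X.X) := inferInstance
  haveI : Module.Finite (IwasawaAlgebra p)
      (D.S ⧸ CastellaGrossiLeeSkinner2022.stabilizedHeegnerModule D C) := inferInstance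
  have h𝔭' : 𝔭.asIdeal = IwasawaAlgebra.augIdealP p := by rw [h𝔭, span_natCast_eq_augIdealP]
  have hμ := h W p K hX9 hK hodd h3 hHN hHp hirr κ hκ γ hγ jbar hhK D C X hfinS hfinX htorC
  rw [Literature.NumberTheory.EllipticCurves.muInvariant_eq_toNat_lengthAt p _ 𝔭 h𝔭',
    Literature.NumberTheory.EllipticCurves.muInvariant_eq_toNat_lengthAt p _ 𝔭 h𝔭'] at hμ
  obtain ⟨a, ha⟩ := ENat.ne_top_iff_exists.mp (Literature.NumberTheory.EllipticCurves.lengthAt_ne_top_of_isTorsion p _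
    (Submodule.torsion_isTorsion (R := IwasawaAlgebra p) (M := X.X)) 𝔭 h𝔭')
  obtain ⟨b, hb⟩ := ENat.ne_top_iff_exists.mp (Literature.NumberTheory.EllipticCurves.lengthAt_ne_top_of_isTorsion p _ htorC 𝔭 h𝔭')
  rw [← ha, ← hb, ENat.toNat_coe, ENat.toNat_coe] at hμ
  rw [← ha, ← hb]
  exact_mod_cast hμ

/-! ## §2 The conditional closer: crux 27077 from the stabilised μ-inequality -/

/-- **The deciding crux from the STABILISED μ-inequality**:
`Stmt.muInequalityStabilized → HowardContainmentLightFramePinnedOfPrintSharp` (BY NAME on the route decl).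
`jbar := IsAlgClosed.lift` along `ιC`; `p ∤ h_K` ↦ `PrintX9Rung.stmt_coprimeTied hMZ` (MZ26 Cor. 4.6, PRINT);
`p ∣ h_K` ↦ the coherent pair `(C₀, F₀)` of `exists_coherent_pair_envelope` (`e = 0`; tower clause from `hTw`,
`[K[p] : K[1]] = p − 1` from `card_ringClassGalOver_prime_one_of_frame`, ordinarity / `E(K)[p] = 0` from
`X9.thm413Hypotheses_of_lightFrame`), torsion of `𝔖/Λκ_{C₀}` from `hNV` (CGLS 4.1.1), `I(ℋ_{F₀}) ⊆ I(Λκ_{C₀})`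
(`heegnerCharIdeal_le_stabilizedHeegnerCharIdeal_of_le`), `(p^m)·I(Λκ_{C₀})² ⊆ char(𝒳_tors)` from `hCGS`
(CGS 6.5.2), and the promotion `IwasawaAlgebra.sq_charIdeal_le_charIdeal_of_span_p_pow_mul_le_of_lengthAt_le_two_mul`
fed with the hypothesis at `(D, C₀, X)`. CONDITIONAL on the residual; credits nothing by itself.
[cite: MastellaZerman2026, Cor. 4.6] [cite: CastellaGrossiLeeSkinner2022, Thm. 4.1.1, Rem. 4.1.4]
[cite: CastellaGrossiSkinner2025, Thm. 6.5.2] [cite: Howard2004HeegnerKolyvagin, §3.3, Thm. 3.3.7] -/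
theorem howardContainmentLightFramePinnedOfPrintSharp_of_muStabilized (hK1 : Stmt.muInequalityStabilized) :
    Summit.BirchSwinnertonDyer.BirchSwinnertonDyer.Theses.PrintX9.HowardContainmentLightFramePinnedOfPrintSharp := by
  have s_cop := Summit.BirchSwinnertonDyer.BirchSwinnertonDyer.Theorems.PrintX9Rung.stmt_coprimeTied
  intro hMZ hNV hCGS hTw W _ _ p _ _ K _ _ hX9 hK hodd h3 hHN hHp hirr κ hκ γ hγ Dt H ιC hc hrk hfin
  letI : Algebra K ℂ := ιC.toAlgebra
  let jbar : AlgebraicClosure K →+* ℂ :=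
    (IsAlgClosed.lift (R := K) (M := ℂ) (S := AlgebraicClosure K)).toRingHom
  by_cases hhK : p ∣ NumberField.classNumber K
  · obtain ⟨D⟩ := LambdaAdicSelmerDataExists.nonempty_lambdaAdicSelmerData (W.baseChange K) p κ hγ
    obtain ⟨X⟩ := (W.baseChange K).nonempty_selmerDualData_holds κ γ hγ
    have hp : p.Prime := Fact.out
    have hX9' := Summit.BirchSwinnertonDyer.BirchSwinnertonDyer.Rank1Residual.classX9_census_of_classX9 W p hX9
    have hp_odd : Odd p := hp.odd_of_ne_two hX9'.ne_two
    have hyp := Summit.BirchSwinnertonDyer.Rank1Residual.X9.thm413Hypotheses_of_lightFrame hX9' hK hodd h3 hHN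
      hHp hκ hγ
    -- the coherent pair `(C₀, F₀)` on `Dt`, envelope exponent `e = 0`
    obtain ⟨C, F, -, hFDt, -, -, hfwd, g, hg, hrev⟩ :=
      exists_coherent_pair_envelope (W := W) hK hHN Dt H.dvd_sq_sub jbar hyp.ordinary hX9'.not_dvd_conductorNorm
        κ hγ (fun k ↦ hTw K p hp_odd hK κ hκ jbar k)
        (card_ringClassGalOver_prime_one_of_frame hK hodd h3 hp hHp jbar) hyp.noPTorsion D
    -- CGLS Thm. 4.1.1 and CGS Thm. 6.5.2 BY NAME at `(D, C₀)`, `(D, C₀, X)`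
    have h411 : CastellaGrossiLeeSkinner2022.thm411_torsionFree_heegnerClass_ne_bot_quotient_isTorsion.{0} := hNV
    have h652 : CastellaGrossiSkinner2025.thm652_stabilized_rankOne_charIdeal_torsion_dvd_pLocalized.{0} := hCGS
    obtain ⟨⟨hfinS, -⟩, hfinX, -, -⟩ := h652 (W.conductorNorm ℤ) W K p κ γ jbar hyp D C X
    haveI := hfinS
    haveI := hfinX
    haveI : IsNoetherian (IwasawaAlgebra p) X.X := isNoetherian_of_isNoetherianRing_of_finite _ _
    haveI : Module.Finite (IwasawaAlgebra p) (Submodule.torsion (IwasawaAlgebra p) X.X) := inferInstance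
    haveI : Module.Finite (IwasawaAlgebra p)
        (D.S ⧸ CastellaGrossiLeeSkinner2022.stabilizedHeegnerModule D C) := inferInstance
    have htorC : Module.IsTorsion (IwasawaAlgebra p)
        (D.S ⧸ CastellaGrossiLeeSkinner2022.stabilizedHeegnerModule D C) :=
      CastellaGrossiLeeSkinner2022.isTorsion_quotient_stabilizedHeegnerModule_of_thm411 h411 hyp D C
    have htorF : Module.IsTorsion (IwasawaAlgebra p) (D.S ⧸ heegnerModule D F) :=
      isTorsion_quotient_heegnerModule_of_smul_stabilizedHeegnerModule_le D F C hg hrev htorC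
    -- `I(ℋ_{F₀}) ⊆ I(Λκ_{C₀})` (envelope at `e = 0`)
    have henv : heegnerCharIdeal D F ≤ CastellaGrossiLeeSkinner2022.stabilizedHeegnerCharIdeal D C :=
      heegnerCharIdeal_le_stabilizedHeegnerCharIdeal_of_le D F C htorF hfwd
    -- `(p^m) · I(Λκ_{C₀})² ⊆ char(𝒳_tors)`
    obtain ⟨m, hm⟩ := CastellaGrossiSkinner2025.span_pow_mul_sq_le_charIdeal_torsion_of_thm652_stabilized h652
      hyp D C X
    -- the residual at `(D, C₀, X)` and the promotion
    have hμ := hK1 W p K hX9 hK hodd h3 hHN hHp hirr κ hκ γ hγ jbar hhK D C X hfinS hfinX htorC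
    have hC2 : CastellaGrossiLeeSkinner2022.stabilizedHeegnerCharIdeal D C ^ 2 ≤
        Module.charIdeal (IwasawaAlgebra p) (Submodule.torsion (IwasawaAlgebra p) X.X) := by
      rw [CastellaGrossiLeeSkinner2022.stabilizedHeegnerCharIdeal_def] at hm ⊢
      exact IwasawaAlgebra.sq_charIdeal_le_charIdeal_of_span_p_pow_mul_le_of_lengthAt_le_two_mul
        (Submodule.torsion_isTorsion (R := IwasawaAlgebra p) (M := X.X)) htorC hμ hm
    exact ⟨jbar, D, F, X, hFDt, (Ideal.pow_right_mono henv 2).trans hC2⟩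
  · obtain ⟨D, F, X, hF, hle⟩ := s_cop hMZ W p K hX9 hK hodd h3 hHN hHp hirr κ hκ γ hγ Dt H ιC jbar hc hrk hfin hhK
    exact ⟨jbar, D, F, X, hF, hle⟩

/-- **The deciding crux from the residual in the `μ`-invariant currency** (`μ(𝒳_tors) ≤ 2 μ(𝔖/Λκ_∞(C))` on light
X9 frames at `p ∣ h_K`). CONDITIONAL; credits nothing by itself. [cite: Howard2004HeegnerKolyvagin, Thm. 2.2.10]
[cite: Washington1997, §13.2] -/
theorem howardContainmentLightFramePinnedOfPrintSharp_of_muInvariantStabilized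
    (hK1 : Stmt.muInvariantInequalityStabilized) :
    Summit.BirchSwinnertonDyer.BirchSwinnertonDyer.Theses.PrintX9.HowardContainmentLightFramePinnedOfPrintSharp :=
  howardContainmentLightFramePinnedOfPrintSharp_of_muStabilized
    (muInequalityStabilized_of_muInvariantInequalityStabilized hK1)

end Summit.BirchSwinnertonDyer.BirchSwinnertonDyer.Theorems.PrintX9SharpMuStabilized

end
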